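import Literature.AnabelianGeometry.EtaleTheta.SettingModelKrullCuspThm16Origin
import Literature.AnabelianGeometry.EtaleTheta.SettingModel2Thm16i
import HarnessLib

/-!
# [EtTh] Thm. 1.6 (i) HOLDS at the cusped untwisted Krull model `modelκ′` for every `Δ`-preserving `γ` — so the
# K3 chain's HYPOTHESIS bundle `IsThm16Origin` AND its CONCLUSION `Thm16i` are inhabited TOGETHER at one model

Mochizuki, *The étale theta function …*, Publ. RIMS **45** (2009) [EtTh], Thm. 1.6 (i) p. 24 (PRIMS p. 250):
«We have: `γ(Π^tp_{Ÿα}) = Π^tp_{Ÿβ}`» [cite: MochizukiEtTh2009, Thm 1.6 (i) p.24]. Cell abc-iut, layer L2 (NV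
lane), seat abc-iut-w5-d165 (gen 4); PROOF-ONLY sequel (0 definitions) of this seat's `SettingModelKrullCuspThm16Origin`
(`modelκ′_isThm16Origin`) — abc-iut-w5-d051's `SettingModel2Thm16i` (`model₂_thm16i`: Thm. 1.6 (i) at the finer
DISCRETE-Galois model, where `IsThm16Origin` is NOT available) TRANSCRIBED to abc-iut-L2-t10's cusped untwisted
Krull carrier `Π^tp_X = Γ ⋊_{θ∘1} G_{ℚ_p}` (`SettingModelKrullCusp`):

* §1 a `Δ`-preserving topological automorphism `γ` of `Γ ⋊_{θ∘1} G_{ℚ_p}` is a PRODUCT: the `Γ`-component of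
  `γ(inr σ)` centralises `inl(Γ)` (the action is trivial, so `inr σ` does) and `Γ` is centre-free
  (abc-iut's `center_gfp_eq_bot`) — `left_apply_inr_κ`, `apply_eq_κ`, `exists_slice_κ`;
* §2 `Π^tp_Ÿ = {g | g.left ∈ Δ^tp_{Y₂}}` at `modelκ′` (`K₂ = ℚ_p(ζ₂, (p²)^{1/2}) = ℚ_p = J̈₁`, abc-iut-w5-d051's
  `fieldKN_bot_qModel_two_mul_one` / `fieldJddN_bot_qModel_one`) — `mem_GtpYdd_modelκ'_iff`;
* §3 **`modelκ'_thm16i`**: `ThetaSetting.Thm16i γ` at `Dα = Dβ = modelκ′ p` for EVERY `Δ`-preserving `γ` (`γ₁`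
  preserves `Δ^tp_{Y₂}` by `map_dY_eq`), and **`ThetaSetting.exists_isThm16Origin_and_forall_thm16i`**: guard +
  `IsThm16Origin` + «Thm. 1.6 (i) for every `Δ`-preserving `γ`» JOINTLY — the hypothesis bundle of the K3 chain
  (`IsThm16Origin.thm16i`, which in addition reads [AbsAnab] Lem. 1.3.8 `hΔ` and [SemiAnbd] Thm. 6.5 (iii) `h65`) is
  consistent WITH its conclusion at one model. (`h65` = `IsoPreservesCuspidalDecomp` at `modelκ′` is NOT examined.)

SEMI-SYNTHETIC model; consistency evidence only; nothing of [EtTh] asserted for genuine tempered fundamental groups;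
no side taken on [IUTchIII] Cor. 3.12; typed ≠ proved.
-/

noncomputable section

namespace Literature.AnabelianGeometry.EtaleTheta.SettingModel

open Literature.AnabelianGeometry.SemiGraphs Function _root_.Topology

variable (p : ℕ) [Fact p.Prime]

/-! ## §1. `Δ`-preserving topological automorphisms of `Γ ⋊_{θ∘1} G_{ℚ_p}` are products -/

/-- A `Δ`-preserving automorphism keeps the `inl(Γ)`-slice: `(γ (inl x)).right = 1`. [cite: MochizukiEtTh2009, Thm 1.6 (i) p.24] -/
theorem right_apply_inl_κ (γ : PiTpκ p ≃ₜ* PiTpκ p)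
    (hΔ : (curveκ' p).DeltaTemp.map γ.toMulEquiv.toMonoidHom = (curveκ' p).DeltaTemp) (x : Gfp) :
    (γ (SemidirectProduct.inl x)).right = 1 := by
  have h : γ (SemidirectProduct.inl x) ∈ (curveκ' p).DeltaTemp.map γ.toMulEquiv.toMonoidHom :=
    ⟨SemidirectProduct.inl x, (mem_deltaTempκ_iff p _).mpr (SemidirectProduct.right_inl x), rfl⟩
  rw [hΔ] at h
  exact (mem_deltaTempκ_iff p _).mp h

/-- The inverse of a `Δ`-preserving automorphism is `Δ`-preserving (κ-carrier). [cite: MochizukiEtTh2009, Thm 1.6 (i) p.24] -/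
theorem map_deltaTemp_symm_eq_κ (γ : PiTpκ p ≃ₜ* PiTpκ p)
    (hΔ : (curveκ' p).DeltaTemp.map γ.toMulEquiv.toMonoidHom = (curveκ' p).DeltaTemp) :
    (curveκ' p).DeltaTemp.map γ.symm.toMulEquiv.toMonoidHom = (curveκ' p).DeltaTemp := by
  have h1 : (curveκ' p).DeltaTemp.map γ.symm.toMulEquiv.toMonoidHom =
      (curveκ' p).DeltaTemp.comap γ.toMulEquiv.toMonoidHom := by
    ext g
    rw [Subgroup.mem_comap]
    constructor
    · rintro ⟨h, hh, rfl⟩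
      change γ (γ.symm h) ∈ (curveκ' p).DeltaTemp
      rw [γ.apply_symm_apply]
      exact hh
    · intro hg
      exact ⟨γ g, hg, γ.symm_apply_apply g⟩
  calc (curveκ' p).DeltaTemp.map γ.symm.toMulEquiv.toMonoidHom
      = (curveκ' p).DeltaTemp.comap γ.toMulEquiv.toMonoidHom := h1
    _ = ((curveκ' p).DeltaTemp.map γ.toMulEquiv.toMonoidHom).comap γ.toMulEquiv.toMonoidHom := by
        rw [hΔ]
    _ = (curveκ' p).DeltaTemp :=
        Subgroup.comap_map_eq_self_of_injective (f := γ.toMulEquiv.toMonoidHom)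
          (fun a b h => γ.injective h) _

/-- Surjectivity of the `Γ`-slice map: every `inl y` is `γ (inl x)`. [cite: MochizukiEtTh2009, Thm 1.6 (i) p.24] -/
theorem exists_apply_inl_eq_κ (γ : PiTpκ p ≃ₜ* PiTpκ p)
    (hΔ : (curveκ' p).DeltaTemp.map γ.toMulEquiv.toMonoidHom = (curveκ' p).DeltaTemp) (y : Gfp) :
    ∃ x : Gfp, γ (SemidirectProduct.inl x) = SemidirectProduct.inl y := by
  have hy : (SemidirectProduct.inl y : PiTpκ p) ∈ (curveκ' p).DeltaTemp.map γ.toMulEquiv.toMonoidHom := by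
    rw [hΔ]; exact (mem_deltaTempκ_iff p _).mpr (SemidirectProduct.right_inl y)
  obtain ⟨d, hd, hdy⟩ := hy
  refine ⟨d.left, ?_⟩
  have hd2 : d.right = 1 := (mem_deltaTempκ_iff p d).mp hd
  rw [← eq_inl_of_right_eq_one_κ hd2]
  exact hdy

/-- **The arithmetic slice is untouched on the `Γ`-side**: `(γ (inr σ)).left = 1` — `inr σ` centralises `inl(Γ)`
(the action is TRIVIAL), hence so does `γ(inr σ)` centralise `γ(inl Γ) = inl Γ`, and `Γ` is centre-free.
[cite: MochizukiEtTh2009, Thm 1.6 (i) p.24] -/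
theorem left_apply_inr_κ (γ : PiTpκ p ≃ₜ* PiTpκ p)
    (hΔ : (curveκ' p).DeltaTemp.map γ.toMulEquiv.toMonoidHom = (curveκ' p).DeltaTemp) (σ : GQp p) :
    (γ (SemidirectProduct.inr σ)).left = 1 := by
  have hcen : (γ (SemidirectProduct.inr σ)).left ∈ Subgroup.center Gfp := by
    rw [Subgroup.mem_center_iff]
    intro y
    obtain ⟨x, hx⟩ := exists_apply_inl_eq_κ p γ hΔ y
    have hcomm : (SemidirectProduct.inl x : PiTpκ p) * SemidirectProduct.inr σ =
        SemidirectProduct.inr σ * SemidirectProduct.inl x := by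
      refine SemidirectProduct.ext ?_ ?_
      · rw [SemidirectProduct.mul_left, SemidirectProduct.mul_left, SemidirectProduct.left_inl,
          SemidirectProduct.right_inl, SemidirectProduct.left_inr, SemidirectProduct.right_inr, actκ_apply_eq,
          actκ_apply_eq, mul_one, one_mul]
      · rw [SemidirectProduct.mul_right, SemidirectProduct.mul_right, SemidirectProduct.right_inl,
          SemidirectProduct.right_inr, one_mul, mul_one]
    have h := congrArg (fun g => (γ g).left) hcomm
    simp only [map_mul, SemidirectProduct.mul_left, actκ_apply_eq, hx, SemidirectProduct.left_inl] at h
    -- `h : y * (γ (inr σ)).left = (γ (inr σ)).left * y`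
    exact h
  rw [center_gfp_eq_bot, Subgroup.mem_bot] at hcen
  exact hcen

/-- **Product decomposition**: `γ g = ⟨(γ (inl g.left)).left, (γ (inr g.right)).right⟩` for a `Δ`-preserving `γ`.
[cite: MochizukiEtTh2009, Thm 1.6 (i) p.24] -/
theorem apply_left_eq_κ (γ : PiTpκ p ≃ₜ* PiTpκ p)
    (hΔ : (curveκ' p).DeltaTemp.map γ.toMulEquiv.toMonoidHom = (curveκ' p).DeltaTemp) (g : PiTpκ p) :
    (γ g).left = (γ (SemidirectProduct.inl g.left)).left := by
  conv_lhs => rw [← SemidirectProduct.inl_left_mul_inr_right g, map_mul]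
  rw [SemidirectProduct.mul_left, actκ_apply_eq, left_apply_inr_κ p γ hΔ, mul_one]

/-- The `Γ`-slice of a `Δ`-preserving topological automorphism, as a topological automorphism of `Γ`.
[cite: MochizukiEtTh2009, Thm 1.6 (i) p.24] -/
theorem exists_slice_κ (γ : PiTpκ p ≃ₜ* PiTpκ p)
    (hΔ : (curveκ' p).DeltaTemp.map γ.toMulEquiv.toMonoidHom = (curveκ' p).DeltaTemp) :
    ∃ γ₁ : Gfp ≃ₜ* Gfp, ∀ x : Gfp, γ₁ x = (γ (SemidirectProduct.inl x)).left := by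
  have hΔ' := map_deltaTemp_symm_eq_κ p γ hΔ
  have h1 : ∀ x : Gfp, γ (SemidirectProduct.inl x) = SemidirectProduct.inl ((γ (SemidirectProduct.inl x)).left) :=
    fun x => eq_inl_of_right_eq_one_κ (right_apply_inl_κ p γ hΔ x)
  have h2 : ∀ y : Gfp, γ.symm (SemidirectProduct.inl y) =
      SemidirectProduct.inl ((γ.symm (SemidirectProduct.inl y)).left) :=
    fun y => eq_inl_of_right_eq_one_κ (right_apply_inl_κ p γ.symm hΔ' y)
  let e : Gfp ≃* Gfp :=
    { toFun := fun x => (γ (SemidirectProduct.inl x)).left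
      invFun := fun y => (γ.symm (SemidirectProduct.inl y)).left
      left_inv := fun x => by
        show (γ.symm (SemidirectProduct.inl (γ (SemidirectProduct.inl x)).left)).left = x
        rw [← h1 x, γ.symm_apply_apply, SemidirectProduct.left_inl]
      right_inv := fun y => by
        show (γ (SemidirectProduct.inl (γ.symm (SemidirectProduct.inl y)).left)).left = y
        rw [← h2 y, γ.apply_symm_apply, SemidirectProduct.left_inl]
      map_mul' := fun x y => by
        show (γ (SemidirectProduct.inl (x * y))).left =
          (γ (SemidirectProduct.inl x)).left * (γ (SemidirectProduct.inl y)).left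
        rw [map_mul, map_mul, SemidirectProduct.mul_left, actκ_apply_eq] }
  refine ⟨ContinuousMulEquiv.mk e ?_ ?_, fun x => rfl⟩
  · exact (Semidirect.continuous_left (isInducing_leftRightκ p)).comp (γ.continuous.comp (continuous_inlκ p))
  · exact (Semidirect.continuous_left (isInducing_leftRightκ p)).comp (γ.symm.continuous.comp (continuous_inlκ p))

/-! ## §2. `Π^tp_Ÿ = {g | g.left ∈ Δ^tp_{Y₂}}` at `modelκ′` -/

/-- **`Π^tp_Ÿ` of `modelκ′` is `Δ^tp_{Y₂} ⋊ G_{ℚ_p}`**: `K₂ = J̈₁ = ℚ_p`. [cite: MochizukiEtTh2009, §1 p.17] -/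
theorem mem_GtpYdd_modelκ'_iff (g : PiTpκ p) :
    g ∈ (ThetaSetting.modelκ' p).GtpYdd ↔ g.left ∈ dY (2 * 1) := by
  change g ∈ YNκ p (2 * 1) ⊓
      ((fieldJddN (⊥ : IntermediateField ℚ_[p] (PadicAlgCl p)) (qModel p) 1).fixingSubgroup).comap
        (augκ p).toMonoidHom ↔ _
  rw [fieldJddN_bot_qModel_one, IntermediateField.fixingSubgroup_bot, Subgroup.comap_top, inf_top_eq,
    YNκ, GfpTwistData.mem_YN, fieldKN_bot_qModel_two_mul_one, IntermediateField.fixingSubgroup_bot]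
  exact ⟨fun h => h.1, fun h => ⟨h, Subgroup.mem_top _⟩⟩

/-! ## §3. Thm. 1.6 (i) at `modelκ′` -/

/-- **[EtTh] Thm. 1.6 (i) HOLDS at `modelκ′`**: for EVERY topological automorphism `γ` of `Π^tp_X` preserving
`Δ^tp_X`, `γ(Π^tp_Ÿ) = Π^tp_Ÿ` (`ThetaSetting.Thm16i γ` at `Dα = Dβ = modelκ′ p`): `Π^tp_Ÿ = Δ^tp_{Y₂} ⋊ G_{ℚ_p}`,
`γ = γ₁ ⋊ α`, and `γ₁` preserves `Δ^tp_{Y₂}` (`map_dY_eq`). [cite: MochizukiEtTh2009, Thm 1.6 (i) p.24] -/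
theorem modelκ'_thm16i (γ : (ThetaSetting.modelκ' p).PiTemp ≃ₜ* (ThetaSetting.modelκ' p).PiTemp)
    (hΔ : (ThetaSetting.modelκ' p).DeltaTemp.map γ.toMulEquiv.toMonoidHom =
      (ThetaSetting.modelκ' p).DeltaTemp) :
    ThetaSetting.Thm16i γ := by
  have hΔ' := map_deltaTemp_symm_eq_κ p γ hΔ
  obtain ⟨γ₁, hγ₁⟩ := exists_slice_κ p γ hΔ
  obtain ⟨δ₁, hδ₁⟩ := exists_slice_κ p γ.symm hΔ'
  unfold ThetaSetting.Thm16i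
  ext g
  rw [mem_GtpYdd_modelκ'_iff]
  constructor
  · rintro ⟨h, hh, rfl⟩
    have hh' : h.left ∈ dY (2 * 1) := (mem_GtpYdd_modelκ'_iff p h).mp hh
    change (γ h).left ∈ dY (2 * 1)
    rw [apply_left_eq_κ p γ hΔ h, ← hγ₁]
    exact (apply_mem_dY_iff γ₁ _ h.left).mpr hh'
  · intro hg
    refine ⟨γ.symm g, ?_, γ.apply_symm_apply g⟩
    change γ.symm g ∈ (ThetaSetting.modelκ' p).GtpYdd
    rw [mem_GtpYdd_modelκ'_iff, apply_left_eq_κ p γ.symm hΔ' g, ← hδ₁]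
    exact (apply_mem_dY_iff δ₁ _ g.left).mpr hg

/-- **The K3 chain's hypothesis bundle AND its conclusion, TOGETHER**: there is a `ThetaSetting p` with the guard
`IsEtThOrigin`, the origin clauses `IsThm16Origin`, and «Thm. 1.6 (i) for every `Δ`-preserving `γ`» — witness
`modelκ′` (at `model₂` the conclusion held without the hypotheses, `SettingModel2Thm16i`; at `modelχ′`/`modelχq′` the
hypotheses failed by R2). [cite: MochizukiEtTh2009, Thm 1.6 (i) p.24] -/
theorem _root_.Literature.AnabelianGeometry.EtaleTheta.ThetaSetting.exists_isThm16Origin_and_forall_thm16i :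
    ∃ D : ThetaSetting p, D.IsEtThOrigin ∧ D.IsThm16Origin ∧
      ∀ γ : D.PiTemp ≃ₜ* D.PiTemp,
        D.DeltaTemp.map γ.toMulEquiv.toMonoidHom = D.DeltaTemp → ThetaSetting.Thm16i γ :=
  ⟨ThetaSetting.modelκ' p, ThetaSetting.modelκ'_isEtThOrigin p, ThetaSetting.modelκ'_isThm16Origin p,
    fun γ hΔ => modelκ'_thm16i p γ hΔ⟩

end Literature.AnabelianGeometry.EtaleTheta.SettingModel

end
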